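import Summits.ValiantsHypothesis.ValiantsHypothesis.Theorems.KPlusLogSqLawLiftingNewtonWindows

/-!
# `MatrixDescartes` — ROBUST DESCARTES RULE ON A WINDOW (kit): Euler cuts, Rolle count, survivor criterion

HONEST FRAMING.  Object-search cell `pub-symmetroid`, crux `Theses.LacunarySymmetroid.MatrixDescartes` (ledger item
`stmt-ValiantsHypothesis-18050`, route `LacunarySymmetroid`; seat `val-sym-mdr-p2`, gen 13).  The crux implies `VP ≠ VNP`
by the route's assembly; NOTHING here is progress on it, and nothing here is a claim about `VP ≠ VNP`, `DoorA26` /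
`DoorA34` or the cell's registers.  This file is elementary real-polynomial theory (no matrices yet).

LAGUERRE'S PROOF OF DESCARTES' RULE, MADE QUANTITATIVE.  For a real polynomial written as a finite sum of monomials
`p = ∑_{i ∈ s} c i · X^(e i)` (exponents may repeat) and a real CUT `α`, the Euler step
`(θ − α) p := X·p′ − α·p = ∑ c i·(e i − α)·X^(e i)` rescales the monomial `X^n` by `n − α` (`euler_sum`), and by Rolle's
theorem applied to `x^(−α)·p(x)` on a window `[u, v] ⊂ (0, ∞)` the polynomial `p` has at most one more zero in `[u, v]`
than `(θ − α) p` (`card_roots_Icc_le_euler_succ`).  Iterating over a finite set `A` of cuts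
(`card_roots_Icc_le_cuts_add_card`): `#{zeros of p in [u,v]} ≤ #{zeros of p_A in [u,v]} + #A`, where
`p_A = ∑ c i·∏_{α ∈ A}(e i − α)·X^(e i)`.  Hence the CORE RULE (`card_roots_Icc_le_card_cuts`): if `p_A` has no zero in
`[u, v]`, then `p` has at most `#A` zeros there.  Laguerre (1883; Pólya–Szegő, *Problems and Theorems in Analysis II*,
Part V, Problem 77) takes the cuts in the sign-change gaps of the exponent sequence, which makes `p_A` one-signed;
here the cuts are free, and the typical certificate that `p_A` is zero-free on the window is DOMINATION BY ONE SURVIVING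
MONOMIAL (`no_roots_Icc_of_survivor`): cutting AT every exponent of a chosen finite set except one survivor `a⋆` kills those
monomials exactly, and if the surviving coefficient times `∏|a⋆ − α|·x^a⋆` beats the `∏|e i − α|`-weighted absolute mass
of all OTHER monomials at the two endpoints `u, v` (convexity transport, tree
`KPlusLogSqLaw.ExactPatchwork.sum_mul_pow_lt_of_endpoints`), then `p_A` has no zero in `[u, v]`
(`card_roots_Icc_le_of_survivor`).  The point: monomials OUTSIDE the chosen exponent set — wherever their exponents lie,
also BETWEEN the chosen ones — are not counted, as long as their weighted mass is dominated.  This is the mechanism of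
the OVERLAP WINDOW LAW for lacunary matrix pencils (sequel file `…OverlapWindow`): a window pays only for the monomials of
its live sub-pencil.
NEIGHBOURS IN THE TREE (different statements): the coefficient-range window rules
`KPlusLogSqLaw.WindowDescartes.window_descartes_card_roots` (variation-diminishing kernel) and
`KPlusLogSqLaw.LocalDescartes.card_le_signVar_window` / `card_roots_Ioo_le_signVar_twoPoint` (two-point Laguerre rule)
count ALL coefficients whose exponents lie in the window's range; the Rouché window law
`LacunarySymmetroidMatrixDescartes.RoucheWindow.card_realRoots_window_le` is complex-analytic and two-letter.
No `def`; Mathlib + one tree lemma.  [folklore] (Laguerre's method; Pólya–Szegő V.77).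
-/

-- `Summit.ValiantsHypothesis.ValiantsHypothesis.…` repeats a component by the D-0017 layout (single-conjunct summit).
set_option linter.dupNamespace false

namespace Summit.ValiantsHypothesis.ValiantsHypothesis.Theorems.LacunarySymmetroidMatrixDescartes.RobustDescartes

open Polynomial Finset Set
open scoped BigOperators

/-! ## §1 The Euler step on a finite sum of monomials -/

/-- **Euler step.**  For `p = ∑_{i∈s} c i · X^(e i)` and a real cut `α`:
`X · p′ − C α · p = ∑_{i∈s} c i · (e i − α) · X^(e i)`. [folklore] -/
theorem euler_sum {ι : Type*} (s : Finset ι) (c : ι → ℝ) (e : ι → ℕ) (α : ℝ) :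
    X * derivative (∑ i ∈ s, C (c i) * X ^ (e i)) - C α * (∑ i ∈ s, C (c i) * X ^ (e i))
      = ∑ i ∈ s, C (c i * ((e i : ℝ) - α)) * X ^ (e i) := by
  rw [derivative_sum, Finset.mul_sum, Finset.mul_sum, ← Finset.sum_sub_distrib]
  refine Finset.sum_congr rfl fun i _ => ?_
  rcases Nat.eq_zero_or_pos (e i) with h0 | hpos
  · rw [h0, pow_zero, mul_one, derivative_C, mul_zero, zero_sub, map_mul, map_sub, map_natCast]
    simp only [Nat.cast_zero, zero_sub]
    ring
  · obtain ⟨k, hk⟩ := Nat.exists_eq_succ_of_ne_zero hpos.ne'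
    rw [hk, derivative_C_mul_X_pow, Nat.succ_sub_one, map_mul, map_mul, map_sub, map_natCast, pow_succ]
    ring

/-! ## §2 Rolle: zeros of `p` versus zeros of `X·p′ − α·p` in a window `[u, v] ⊂ (0, ∞)` -/

/-- **Rolle count for one Euler step.**  Let `0 < u` and `q = X·p′ − C α·p ≠ 0`.  Then `p` has at most one more distinct zero
in `[u, v]` than `q`: between two consecutive zeros of `p` the function `x ↦ x^(−α)·p(x)` has a critical point, where
`x^(−α−1)·q(x) = 0`. [folklore] -/
theorem card_roots_Icc_le_euler_succ (p : ℝ[X]) (α : ℝ) {u v : ℝ} (hu : 0 < u)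
    (hq : X * derivative p - C α * p ≠ 0) :
    (p.roots.toFinset.filter (fun x => x ∈ Icc u v)).card ≤
      ((X * derivative p - C α * p).roots.toFinset.filter (fun x => x ∈ Icc u v)).card + 1 := by
  classical
  have hp : p ≠ 0 := by
    rintro rfl
    exact hq (by simp)
  set q : ℝ[X] := X * derivative p - C α * p with hqdef
  refine (Finset.card_le_sdiff_of_interleaved fun x hx y hy hxy _ => ?_).trans
    (Nat.add_le_add_right (Finset.card_le_card Finset.sdiff_subset) 1)
  rw [Finset.mem_filter, Multiset.mem_toFinset, mem_roots hp] at hx hy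
  have hx0 : 0 < x := hu.trans_le hx.2.1
  -- Rolle for `φ(t) = t^(−α) · p(t)` on `[x, y]`
  set φ : ℝ → ℝ := fun t => t ^ (-α) * p.eval t with hφ
  have hφder : ∀ t ∈ Ioo x y, HasDerivAt φ (t ^ (-α - 1) * q.eval t) t := by
    intro t ht
    have ht0 : t ≠ 0 := (hx0.trans ht.1).ne'
    have h1 : HasDerivAt (fun t : ℝ => t ^ (-α)) (-α * t ^ (-α - 1)) t := Real.hasDerivAt_rpow_const (Or.inl ht0)
    have h2 := h1.mul (p.hasDerivAt t)
    refine h2.congr_deriv ?_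
    have ht' : t ^ (-α) = t ^ (-α - 1) * t := by
      rw [Real.rpow_sub_one ht0, div_mul_cancel₀ _ ht0]
    rw [hqdef, eval_sub, eval_mul, eval_X, eval_mul, eval_C, ht']
    ring
  have hφcont : ContinuousOn φ (Icc x y) := by
    intro t ht
    have ht0 : t ≠ 0 := (hx0.trans_le ht.1).ne'
    exact ((Real.continuousAt_rpow_const t (-α) (Or.inl ht0)).mul
      (p.continuous_aeval.continuousAt)).continuousWithinAt
  have hφx : φ x = 0 := by simp [hφ, hx.1.eq_zero]
  have hφy : φ y = 0 := by simp [hφ, hy.1.eq_zero]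
  obtain ⟨z, hz, hz'⟩ := exists_hasDerivAt_eq_zero hxy hφcont (hφx.trans hφy.symm) hφder
  have hz0 : 0 < z := hx0.trans hz.1
  have hqz : q.eval z = 0 := by
    rcases mul_eq_zero.1 hz' with h | h
    · exact absurd h (Real.rpow_pos_of_pos hz0 _).ne'
    · exact h
  refine ⟨z, ?_, hz.1, hz.2⟩
  rw [Finset.mem_filter, Multiset.mem_toFinset, mem_roots hq]
  exact ⟨hqz, hx.2.1.trans hz.1.le, hz.2.le.trans hy.2.2⟩

/-- **Rolle count for a finite set of cuts.**  For `p = ∑_{i∈s} c i · X^(e i)`, a finite set `A` of real cuts and the cut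
polynomial `p_A = ∑_{i∈s} c i · ∏_{α∈A}(e i − α) · X^(e i)`: if `p_A ≠ 0` then, in any window `[u, v]` with `0 < u`,
`#{zeros of p} ≤ #{zeros of p_A} + #A`. [folklore] -/
theorem card_roots_Icc_le_cuts_add_card {ι : Type*} (s : Finset ι) (c : ι → ℝ) (e : ι → ℕ) (A : Finset ℝ)
    {u v : ℝ} (hu : 0 < u)
    (hA : (∑ i ∈ s, C (c i * ∏ α ∈ A, ((e i : ℝ) - α)) * X ^ (e i)) ≠ 0) :
    ((∑ i ∈ s, C (c i) * X ^ (e i)).roots.toFinset.filter (fun x => x ∈ Icc u v)).card ≤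
      ((∑ i ∈ s, C (c i * ∏ α ∈ A, ((e i : ℝ) - α)) * X ^ (e i)).roots.toFinset.filter
        (fun x => x ∈ Icc u v)).card + A.card := by
  classical
  induction A using Finset.induction_on with
  | empty => simp
  | insert α A hαA ih =>
    -- the cut polynomial for `insert α A` is one Euler step of the cut polynomial for `A`
    have hstep : (∑ i ∈ s, C (c i * ∏ β ∈ insert α A, ((e i : ℝ) - β)) * X ^ (e i)) =
        X * derivative (∑ i ∈ s, C (c i * ∏ β ∈ A, ((e i : ℝ) - β)) * X ^ (e i)) -
          C α * (∑ i ∈ s, C (c i * ∏ β ∈ A, ((e i : ℝ) - β)) * X ^ (e i)) := by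
      rw [euler_sum]
      refine Finset.sum_congr rfl fun i _ => ?_
      rw [Finset.prod_insert hαA]
      ring_nf
    have hA' : (∑ i ∈ s, C (c i * ∏ β ∈ A, ((e i : ℝ) - β)) * X ^ (e i)) ≠ 0 := by
      intro h0
      apply hA
      rw [hstep, h0]
      simp
    have h1 := ih hA'
    have h2 := card_roots_Icc_le_euler_succ (∑ i ∈ s, C (c i * ∏ β ∈ A, ((e i : ℝ) - β)) * X ^ (e i)) α
      (v := v) hu (by rw [← hstep]; exact hA)
    rw [← hstep] at h2
    rw [Finset.card_insert_of_notMem hαA]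
    omega

/-- **CORE RULE.**  If the cut polynomial `p_A` has no zero in the window `[u, v]` (`0 < u ≤ v`), then `p` has at most `#A`
distinct zeros in `[u, v]`.  (With `u ≤ v` the window is non-empty, so `p_A ≠ 0`.) [folklore] -/
theorem card_roots_Icc_le_card_cuts {ι : Type*} (s : Finset ι) (c : ι → ℝ) (e : ι → ℕ) (A : Finset ℝ)
    {u v : ℝ} (hu : 0 < u) (huv : u ≤ v)
    (hno : ∀ x ∈ Icc u v, (∑ i ∈ s, C (c i * ∏ α ∈ A, ((e i : ℝ) - α)) * X ^ (e i)).eval x ≠ 0) :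
    ((∑ i ∈ s, C (c i) * X ^ (e i)).roots.toFinset.filter (fun x => x ∈ Icc u v)).card ≤ A.card := by
  classical
  have hA : (∑ i ∈ s, C (c i * ∏ α ∈ A, ((e i : ℝ) - α)) * X ^ (e i)) ≠ 0 := by
    intro h0
    exact hno u ⟨le_rfl, huv⟩ (by rw [h0, eval_zero])
  have hempty : ((∑ i ∈ s, C (c i * ∏ α ∈ A, ((e i : ℝ) - α)) * X ^ (e i)).roots.toFinset.filter
      (fun x => x ∈ Icc u v)) = ∅ := by
    refine Finset.filter_false_of_mem fun x hx hxW => ?_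
    rw [Multiset.mem_toFinset, mem_roots hA] at hx
    exact hno x hxW hx
  have h := card_roots_Icc_le_cuts_add_card s c e A (v := v) hu hA
  rw [hempty, Finset.card_empty, zero_add] at h
  exact h

/-! ## §3 The survivor certificate: one monomial against the weighted rest, checked at the two endpoints -/

/-- evaluation of a finite sum of monomials. [folklore] -/
theorem eval_sum_C_mul_X_pow {ι : Type*} (s : Finset ι) (c : ι → ℝ) (e : ι → ℕ) (x : ℝ) :
    (∑ i ∈ s, C (c i) * X ^ (e i)).eval x = ∑ i ∈ s, c i * x ^ (e i) := by
  simp only [eval_finsetSum, eval_mul, eval_C, eval_pow, eval_X]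

/-- regrouping a sum of weighted powers by the value of the exponent. [folklore] -/
theorem sum_mul_pow_eq_sum_image {ι : Type*} [DecidableEq ι] (s : Finset ι) (w : ι → ℝ) (e : ι → ℕ) (x : ℝ) :
    ∑ i ∈ s, w i * x ^ (e i) = ∑ n ∈ s.image e, (∑ i ∈ s.filter (fun i => e i = n), w i) * x ^ n := by
  rw [← Finset.sum_fiberwise_of_maps_to (g := e) (fun i hi => Finset.mem_image_of_mem e hi)]
  refine Finset.sum_congr rfl fun n _ => ?_
  rw [Finset.sum_mul]
  refine Finset.sum_congr rfl fun i hi => ?_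
  rw [(Finset.mem_filter.1 hi).2]

/-- **Convexity transport, arbitrary index set.**  A strict inequality `∑_{i∈s} w i · x^(e i) < B · x^a` with `w ≥ 0` on
`s` that holds at two points `0 < p ≤ q` holds on `[p, q]` (after division by `x^a` the left side is a non-negative
combination of integer powers, convex on `(0, ∞)`; tree `KPlusLogSqLaw.ExactPatchwork.sum_mul_pow_lt_of_endpoints`).
[folklore] -/
theorem sum_mul_pow_lt_of_endpoints {ι : Type*} (s : Finset ι) (w : ι → ℝ) (hw : ∀ i ∈ s, 0 ≤ w i) (e : ι → ℕ)
    (a : ℕ) {B p q x : ℝ} (hp : 0 < p) (hpx : p ≤ x) (hxq : x ≤ q)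
    (h1 : ∑ i ∈ s, w i * p ^ (e i) < B * p ^ a) (h2 : ∑ i ∈ s, w i * q ^ (e i) < B * q ^ a) :
    ∑ i ∈ s, w i * x ^ (e i) < B * x ^ a := by
  classical
  rw [sum_mul_pow_eq_sum_image] at h1 h2 ⊢
  refine KPlusLogSqLaw.ExactPatchwork.sum_mul_pow_lt_of_endpoints (s.image e)
    (fun n => ∑ i ∈ s.filter (fun i => e i = n), w i) (fun n => ?_) a hp hpx hxq h1 h2
  exact Finset.sum_nonneg fun i hi => hw i (Finset.mem_filter.1 hi).1

/-- **Survivor certificate at a point.**  Split a finite sum of monomials by a distinguished exponent `a`: if at `x ≥ 0`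
the absolute mass of the monomials of exponent `≠ a` is below `|∑_{e i = a} c i|·x^a`, the sum does not vanish at `x`.
[folklore] -/
theorem eval_ne_zero_of_survivor {ι : Type*} (s : Finset ι) (c : ι → ℝ) (e : ι → ℕ) (a : ℕ) {x : ℝ} (hx : 0 ≤ x)
    (h : ∑ i ∈ s.filter (fun i => e i ≠ a), |c i| * x ^ (e i) <
      |∑ i ∈ s.filter (fun i => e i = a), c i| * x ^ a) :
    (∑ i ∈ s, C (c i) * X ^ (e i)).eval x ≠ 0 := by
  classical
  rw [eval_sum_C_mul_X_pow, ← Finset.sum_filter_add_sum_filter_not s (fun i => e i = a)]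
  have hmain : ∑ i ∈ s.filter (fun i => e i = a), c i * x ^ (e i) =
      (∑ i ∈ s.filter (fun i => e i = a), c i) * x ^ a := by
    rw [Finset.sum_mul]
    refine Finset.sum_congr rfl fun i hi => ?_
    rw [(Finset.mem_filter.1 hi).2]
  have htail : |∑ i ∈ s.filter (fun i => ¬ e i = a), c i * x ^ (e i)| ≤
      ∑ i ∈ s.filter (fun i => e i ≠ a), |c i| * x ^ (e i) := by
    refine (Finset.abs_sum_le_sum_abs _ _).trans (le_of_eq (Finset.sum_congr rfl fun i _ => ?_))
    rw [abs_mul, abs_of_nonneg (pow_nonneg hx _)]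
  intro h0
  rw [hmain] at h0
  have h3 : (∑ i ∈ s.filter (fun i => e i = a), c i) * x ^ a =
      -(∑ i ∈ s.filter (fun i => ¬ e i = a), c i * x ^ (e i)) := by linarith
  have h4 : |(∑ i ∈ s.filter (fun i => e i = a), c i) * x ^ a| ≤
      ∑ i ∈ s.filter (fun i => e i ≠ a), |c i| * x ^ (e i) := by
    rw [h3, abs_neg]; exact htail
  rw [abs_mul, abs_of_nonneg (pow_nonneg hx _)] at h4
  linarith

/-- **ROBUST DESCARTES RULE, survivor form.**  Let `p = ∑_{i∈s} c i · X^(e i)`, let `A` be a finite set of real cuts and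
`a` a distinguished exponent.  If at BOTH endpoints of the window `[u, v]` (`0 < u ≤ v`) the `∏|e i − α|`-weighted absolute
mass of the monomials of exponent `≠ a` is below `|∑_{e i = a} c i·∏(a − α)|·x^a`, then `p` has at most `#A` distinct zeros
in `[u, v]`.  Typical use: `A` = the other exponents of a chosen finite set (they are killed, whatever their coefficients),
`a` the survivor; the monomials outside the chosen set, wherever their exponents lie, are not counted. [folklore] -/
theorem card_roots_Icc_le_of_survivor {ι : Type*} (s : Finset ι) (c : ι → ℝ) (e : ι → ℕ) (A : Finset ℝ) (a : ℕ)
    {u v : ℝ} (hu : 0 < u) (huv : u ≤ v)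
    (hdom_u : ∑ i ∈ s.filter (fun i => e i ≠ a), |c i * ∏ α ∈ A, ((e i : ℝ) - α)| * u ^ (e i) <
      |∑ i ∈ s.filter (fun i => e i = a), c i * ∏ α ∈ A, ((e i : ℝ) - α)| * u ^ a)
    (hdom_v : ∑ i ∈ s.filter (fun i => e i ≠ a), |c i * ∏ α ∈ A, ((e i : ℝ) - α)| * v ^ (e i) <
      |∑ i ∈ s.filter (fun i => e i = a), c i * ∏ α ∈ A, ((e i : ℝ) - α)| * v ^ a) :
    ((∑ i ∈ s, C (c i) * X ^ (e i)).roots.toFinset.filter (fun x => x ∈ Icc u v)).card ≤ A.card := by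
  classical
  refine card_roots_Icc_le_card_cuts s c e A hu huv fun x hx => ?_
  refine eval_ne_zero_of_survivor s _ e a (hu.le.trans hx.1) ?_
  exact sum_mul_pow_lt_of_endpoints (s.filter (fun i => e i ≠ a)) _ (fun i _ => abs_nonneg _) e a hu hx.1 hx.2
    hdom_u hdom_v

/-! ## §4 Laguerre's one-signed form (cuts in the sign-change gaps) -/

/-- **One-signed certificate at a point (Laguerre).**  If at `x ≥ 0` the SIGNED mass `∑_{i∈P} c i·x^(e i)` of a
sub-family `P` exceeds the absolute mass of the monomials outside `P`, the sum does not vanish at `x`.  (Useful when the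
`c i`, `i ∈ P`, are all `≥ 0`: Laguerre's placement of the cuts in the sign-change gaps of the exponent sequence makes ALL cut
coefficients one-signed, `P = s`, and recovers Descartes' bound `#A = #sign changes`; Pólya–Szegő V.77.) [folklore] -/
theorem eval_ne_zero_of_oneSigned {ι : Type*} [DecidableEq ι] (s P : Finset ι) (hP : P ⊆ s) (c : ι → ℝ) (e : ι → ℕ) {x : ℝ}
    (hx : 0 ≤ x)
    (h : ∑ i ∈ s \ P, |c i| * x ^ (e i) < ∑ i ∈ P, c i * x ^ (e i)) :
    (∑ i ∈ s, C (c i) * X ^ (e i)).eval x ≠ 0 := by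
  classical
  rw [eval_sum_C_mul_X_pow, ← Finset.sum_sdiff hP]
  have htail : |∑ i ∈ s \ P, c i * x ^ (e i)| ≤ ∑ i ∈ s \ P, |c i| * x ^ (e i) := by
    refine (Finset.abs_sum_le_sum_abs _ _).trans (le_of_eq (Finset.sum_congr rfl fun i _ => ?_))
    rw [abs_mul, abs_of_nonneg (pow_nonneg hx _)]
  intro h0
  have h3 : ∑ i ∈ P, c i * x ^ (e i) = -(∑ i ∈ s \ P, c i * x ^ (e i)) := by linarith
  have h4 : ∑ i ∈ P, c i * x ^ (e i) ≤ ∑ i ∈ s \ P, |c i| * x ^ (e i) := by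
    rw [h3]; exact (neg_le_abs _).trans htail
  linarith

/-- **ROBUST DESCARTES RULE, one-signed (Laguerre) form.**  Let `p = ∑_{i∈s} c i · X^(e i)`, `A` a finite set of real
cuts, `P ⊆ s` a sub-family (typically the one whose cut coefficients `c i · ∏_{α∈A}(e i − α)` are all `≥ 0`).  If at
every point of the window `[u, v]` (`0 < u ≤ v`) the `∏|e i − α|`-weighted absolute mass of the monomials outside `P` is
below the signed cut mass of `P`, then `p` has at most `#A` distinct zeros in `[u, v]`.  (For the mirror case replace `c`
by `−c`: the roots are the same.) [folklore] -/
theorem card_roots_Icc_le_of_oneSigned {ι : Type*} [DecidableEq ι] (s P : Finset ι) (hP : P ⊆ s) (c : ι → ℝ) (e : ι → ℕ)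
    (A : Finset ℝ) {u v : ℝ} (hu : 0 < u) (huv : u ≤ v)
    (hdom : ∀ x ∈ Icc u v, ∑ i ∈ s \ P, |c i * ∏ α ∈ A, ((e i : ℝ) - α)| * x ^ (e i) <
      ∑ i ∈ P, (c i * ∏ α ∈ A, ((e i : ℝ) - α)) * x ^ (e i)) :
    ((∑ i ∈ s, C (c i) * X ^ (e i)).roots.toFinset.filter (fun x => x ∈ Icc u v)).card ≤ A.card :=
  card_roots_Icc_le_card_cuts s c e A hu huv fun x hx =>
    eval_ne_zero_of_oneSigned s P hP _ e (hu.le.trans hx.1) (hdom x hx)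

end Summit.ValiantsHypothesis.ValiantsHypothesis.Theorems.LacunarySymmetroidMatrixDescartes.RobustDescartes
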